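import Summits.Ventures.LatticeQCDFlow.Scoring.SUNFreeEnergyWeakCoupling2D
import Summits.Ventures.LatticeQCDFlow.Scoring.MehtaIntegral
import Mathlib.MeasureTheory.Measure.Lebesgue.EqHaar
import Mathlib.LinearAlgebra.Matrix.SchurComplement
import HarnessLib

/-!
# Mehta's integral on the hyperplane `Σφ = 0`: `M^{SU}_N = √(2π)^{N−1} sf(N)/√N`, and the `SU(N)` weak-coupling constants in closed form

HONEST FRAMING: exact (Metropolis-corrected) sampling algorithms for lattice gauge theory;
figures of merit are autocorrelation/cost numbers at stated couplings and volumes; no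
continuum-physics claim.

Venture `LatticeQCDFlow` (cell pub-lqcd), sub-topic `Scoring`; FANOUT row 5 (`s0-sun-a`), GEN-20.
NEW WORK of the cell (placement rule).  GEN-20's `SpecialUnitaryLaplace` left the `SU(N)` weak-coupling constant as
the positive Gaussian integral `M^{SU}_N = ∫_{ℝ^{N−1}} e^{−Σ_bφ_b(ψ)²/2} Π_{j≺k}(φ_j(ψ) − φ_k(ψ))² dψ` over the free
phases (`φ_0 = −Σψ`).  The linear change of variables `φ = φ(ψ) + u·𝟙` on `ℝ^N` (determinant `N`, by
`det(1 + AB) = det(1 + BA)` on a rank-two update) has `|φ|² = Σ_bφ_b(ψ)² + N u²` and leaves the Vandermonde factor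
unchanged, so Mehta's integral factorises: `M_N = N · M^{SU}_N · √(2π/N)`, i.e.

* §1 `suShear`, the matrix `1 + U` and **`det_suShear`** (`= N`); §2 `integral_comp_suShear` (`∫ F = N ∫ F ∘ (1+U)`),
  `integral_pi_split_mul` (splitting `ℝ^N = ℝ^{N−1} × ℝ` at the coordinate `0`);
* §3 **`suGaussVandermonde_eq`**: `M^{SU}_N = √(2π)^{N−1} · sf(N) / √N` for every `N ≥ 1`;
* §4 **`tendsto_tsum_det_besselI_weakCoupling'`**: `Σ_q det[I_{|q+i−j|}(x)]_{N×N} e^{−Nx} √x^{N²−1} → sf(N)/(N! √N √(2π)^{N−1})`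
  (`= Π_{j=1}^{N−1} j! / (√N (2π)^{(N−1)/2})`), and **`tendsto_specialUnitary_freeEnergyDensity_two_add_log'`**:
  `f_{SU(N)}(β) + ((N²−1)/2) log β → log(sf(N)/(N! √N √(2π)^{N−1}))`; `specialUnitary_two_weakCoupling_constant`
  (`N = 2`: `−½ log 4π`, GEN-20 (29)'s constant — consistency of the two routes).

No `def`, nothing cited as a fact, 0 sorry.
-/

noncomputable section

open Real MeasureTheory Filter Topology Finset
open Literature.MathematicalPhysics.QuantumLattice (fundamentalRep freeEnergyDensity)
open Literature.Analysis.FunctionSpaces (besselI)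
open Literature.RepresentationTheory.CompactGroups.WeylIntegration (OD)

namespace Summit.Ventures.LatticeQCDFlow.Scoring

/-! ### 1. The shear `φ ↦ (φ_k + φ_0)_{k≠0}, φ_0 − Σ_{k≠0} φ_k` and its determinant -/

section Shear

variable (N : ℕ) [NeZero N]

/-- The sum over the free indices as a filtered sum over `Fin N`. -/
theorem sum_subtype_ne_zero_eq (φ : Fin N → ℝ) :
    ∑ k : {i : Fin N // i ≠ 0}, φ k = ∑ j : Fin N, if j = 0 then 0 else φ j := by
  rw [← Finset.sum_subtype (Finset.univ.filter fun i : Fin N => i ≠ 0) (p := fun i : Fin N => i ≠ 0) (by simp) φ,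
    Finset.sum_filter]
  refine Finset.sum_congr rfl fun j _ => ?_
  by_cases hj : j = 0 <;> simp [hj]

/-- The rank-two update `U = A B` with `A = [a | e₀]`, `B = [e₀ᵀ ; −aᵀ]`, `a = 𝟙 − e₀`: `(1 + U)φ` has coordinates
`φ_k + φ_0` (`k ≠ 0`) and `φ_0 − Σ_{k≠0} φ_k`. -/
theorem one_add_suUpdate_mulVec (φ : Fin N → ℝ) (b : Fin N) :
    Matrix.mulVec ((1 : Matrix (Fin N) (Fin N) ℝ) +
        (Matrix.of fun (i : Fin N) (r : Fin 2) => if r = 0 then (if i = 0 then (0 : ℝ) else 1) else (if i = 0 then 1 else 0)) *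
        (Matrix.of fun (r : Fin 2) (j : Fin N) => if r = 0 then (if j = 0 then (1 : ℝ) else 0) else (if j = 0 then 0 else -1)))
      φ b = if b = 0 then φ 0 - ∑ k : {i : Fin N // i ≠ 0}, φ k else φ b + φ 0 := by
  rw [Matrix.add_mulVec, Matrix.one_mulVec, ← Matrix.mulVec_mulVec, sum_subtype_ne_zero_eq]
  have hB0 : ∑ x : Fin N, (if x = 0 then (1 : ℝ) else 0) * φ x = φ 0 := by
    rw [Finset.sum_eq_single 0 (fun j _ hj => by simp [hj]) (by simp)]
    simp
  have hB1 : ∑ x : Fin N, (if x = 0 then (0 : ℝ) else -1) * φ x = -∑ j : Fin N, if j = 0 then 0 else φ j := by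
    rw [← Finset.sum_neg_distrib]
    refine Finset.sum_congr rfl fun j _ => ?_
    by_cases hj : j = 0 <;> simp [hj]
  simp only [Pi.add_apply, Matrix.mulVec, dotProduct, Fin.sum_univ_two, Fin.isValue, Matrix.of_apply, if_true,
    one_ne_zero, if_false]
  rw [hB0, hB1]
  by_cases hb : b = 0
  · simp only [hb, if_true]; ring
  · simp only [hb, if_false]; ring

/-- **`det(1 + U) = N`**: `det(1 + AB) = det(1₂ + BA)` and `BA = [[0, 1], [−(N−1), 0]]`. -/
theorem det_one_add_suUpdate :
    ((1 : Matrix (Fin N) (Fin N) ℝ) +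
        (Matrix.of fun (i : Fin N) (r : Fin 2) => if r = 0 then (if i = 0 then (0 : ℝ) else 1) else (if i = 0 then 1 else 0)) *
        (Matrix.of fun (r : Fin 2) (j : Fin N) => if r = 0 then (if j = 0 then (1 : ℝ) else 0) else (if j = 0 then 0 else -1))).det
      = N := by
  rw [Matrix.det_one_add_mul_comm, Matrix.det_fin_two]
  have hone : ∑ j : Fin N, (if j = 0 then (1 : ℝ) else 0) = 1 := by
    rw [Finset.sum_ite_eq' Finset.univ (0 : Fin N) (fun _ => (1 : ℝ))]
    simp
  have e00 : ((Matrix.of fun (r : Fin 2) (j : Fin N) => if r = 0 then (if j = 0 then (1 : ℝ) else 0) else (if j = 0 then 0 else -1)) *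
      (Matrix.of fun (i : Fin N) (r : Fin 2) => if r = 0 then (if i = 0 then (0 : ℝ) else 1) else (if i = 0 then 1 else 0))) 0 0 = 0 := by
    simp only [Matrix.mul_apply, Matrix.of_apply, Fin.isValue, if_true]
    exact Finset.sum_eq_zero fun j _ => by by_cases hj : j = 0 <;> simp [hj]
  have e01 : ((Matrix.of fun (r : Fin 2) (j : Fin N) => if r = 0 then (if j = 0 then (1 : ℝ) else 0) else (if j = 0 then 0 else -1)) *
      (Matrix.of fun (i : Fin N) (r : Fin 2) => if r = 0 then (if i = 0 then (0 : ℝ) else 1) else (if i = 0 then 1 else 0))) 0 1 = 1 := by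
    simp only [Matrix.mul_apply, Matrix.of_apply, Fin.isValue, if_true, one_ne_zero, if_false]
    rw [← hone]
    refine Finset.sum_congr rfl fun j _ => ?_
    by_cases hj : j = 0 <;> simp [hj]
  have e10 : ((Matrix.of fun (r : Fin 2) (j : Fin N) => if r = 0 then (if j = 0 then (1 : ℝ) else 0) else (if j = 0 then 0 else -1)) *
      (Matrix.of fun (i : Fin N) (r : Fin 2) => if r = 0 then (if i = 0 then (0 : ℝ) else 1) else (if i = 0 then 1 else 0))) 1 0
      = -(N - 1) := by
    simp only [Matrix.mul_apply, Matrix.of_apply, Fin.isValue, one_ne_zero, if_false, if_true]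
    have hterm : ∀ j : Fin N, ((if j = 0 then (0 : ℝ) else -1) * if j = 0 then 0 else 1) = -1 + (if j = 0 then 1 else 0) := by
      intro j; by_cases hj : j = 0 <;> simp [hj]
    simp_rw [hterm]
    rw [Finset.sum_add_distrib, hone, Finset.sum_const, Finset.card_univ, Fintype.card_fin, nsmul_eq_mul]
    ring
  have e11 : ((Matrix.of fun (r : Fin 2) (j : Fin N) => if r = 0 then (if j = 0 then (1 : ℝ) else 0) else (if j = 0 then 0 else -1)) *
      (Matrix.of fun (i : Fin N) (r : Fin 2) => if r = 0 then (if i = 0 then (0 : ℝ) else 1) else (if i = 0 then 1 else 0))) 1 1 = 0 := by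
    simp only [Matrix.mul_apply, Matrix.of_apply, Fin.isValue, one_ne_zero, if_false]
    exact Finset.sum_eq_zero fun j _ => by by_cases hj : j = 0 <;> simp [hj]
  simp only [Matrix.add_apply, Matrix.one_apply_eq, Matrix.one_apply_ne (show (0 : Fin 2) ≠ 1 by decide),
    Matrix.one_apply_ne (show (1 : Fin 2) ≠ 0 by decide), e00, e01, e10, e11]
  ring

end Shear

/-! ### 2. Change of variables on `ℝ^N` and the splitting `ℝ^N = ℝ^{N−1} × ℝ` -/

section CoV

variable (N : ℕ) [NeZero N]

/-- **Linear change of variables by the shear**: `∫_{ℝ^N} g = N · ∫_{ℝ^N} g ∘ (1 + U)` (Jacobian `|det(1+U)| = N`). -/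
theorem integral_eq_mul_integral_comp_suShear (g : (Fin N → ℝ) → ℝ) :
    ∫ φ : Fin N → ℝ, g φ = N * ∫ φ : Fin N → ℝ, g (Matrix.mulVec ((1 : Matrix (Fin N) (Fin N) ℝ) +
        (Matrix.of fun (i : Fin N) (r : Fin 2) => if r = 0 then (if i = 0 then (0 : ℝ) else 1) else (if i = 0 then 1 else 0)) *
        (Matrix.of fun (r : Fin 2) (j : Fin N) => if r = 0 then (if j = 0 then (1 : ℝ) else 0) else (if j = 0 then 0 else -1)))
      φ) := by
  set M : Matrix (Fin N) (Fin N) ℝ := (1 : Matrix (Fin N) (Fin N) ℝ) +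
        (Matrix.of fun (i : Fin N) (r : Fin 2) => if r = 0 then (if i = 0 then (0 : ℝ) else 1) else (if i = 0 then 1 else 0)) *
        (Matrix.of fun (r : Fin 2) (j : Fin N) => if r = 0 then (if j = 0 then (1 : ℝ) else 0) else (if j = 0 then 0 else -1))
    with hM
  have hdet : M.det = N := det_one_add_suUpdate N
  have hU : IsUnit M := by
    rw [Matrix.isUnit_iff_isUnit_det, hdet]
    exact isUnit_iff_ne_zero.2 (Nat.cast_ne_zero.2 (NeZero.ne N))
  set L : (Fin N → ℝ) →L[ℝ] (Fin N → ℝ) := LinearMap.toContinuousLinearMap (Matrix.toLin' M) with hL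
  have hLapp : ∀ φ, L φ = Matrix.mulVec M φ := fun φ => by simp [hL]
  have hLdet : L.det = N := by
    rw [← hdet, ← LinearMap.det_toLin' (R := ℝ) M]
    rfl
  have hderiv : ∀ x ∈ (Set.univ : Set (Fin N → ℝ)), HasFDerivWithinAt (fun φ => Matrix.mulVec M φ) L Set.univ x := by
    intro x _
    have h := L.hasFDerivAt (x := x)
    have hfun : (L : (Fin N → ℝ) → (Fin N → ℝ)) = fun φ => Matrix.mulVec M φ := funext hLapp
    rw [hfun] at h
    exact h.hasFDerivWithinAt
  have hinj : Set.InjOn (fun φ => Matrix.mulVec M φ) Set.univ :=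
    (Matrix.mulVec_injective_iff_isUnit.2 hU).injOn
  have hsurj : (fun φ => Matrix.mulVec M φ) '' Set.univ = Set.univ :=
    Set.image_univ_of_surjective (Matrix.mulVec_surjective_iff_isUnit.2 hU)
  have h := integral_image_eq_integral_abs_det_fderiv_smul (μ := volume) MeasurableSet.univ hderiv hinj g
  rw [hsurj, setIntegral_univ, setIntegral_univ] at h
  rw [h]
  simp only [hLdet, smul_eq_mul, Nat.abs_cast]
  rw [integral_const_mul]

/-- **Splitting `ℝ^N = ℝ^{N−1} × ℝ` at the coordinate `0`** for a product integrand: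
`∫_{ℝ^N} g(φ|_{≠0}) h(φ_0) dφ = (∫_{ℝ^{N−1}} g) · (∫_ℝ h)`. -/
theorem integral_pi_split_mul (g : ({i : Fin N // i ≠ 0} → ℝ) → ℝ) (h : ℝ → ℝ) :
    ∫ φ : Fin N → ℝ, g (fun k => φ k) * h (φ 0) = (∫ ψ : {i : Fin N // i ≠ 0} → ℝ, g ψ) * ∫ u : ℝ, h u := by
  letI hU : Unique {i : Fin N // ¬(i ≠ (0 : Fin N))} :=
    { default := ⟨0, fun h => h rfl⟩, uniq := fun x => Subtype.ext (not_ne_iff.1 x.2) }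
  have hd : ((default : {i : Fin N // ¬(i ≠ (0 : Fin N))}) : Fin N) = 0 :=
    not_ne_iff.1 (default : {i : Fin N // ¬(i ≠ (0 : Fin N))}).property
  set e := MeasurableEquiv.piEquivPiSubtypeProd (fun _ : Fin N => ℝ) (fun i : Fin N => i ≠ 0) with he
  have hmp : MeasurePreserving e volume volume := volume_preserving_piEquivPiSubtypeProd (fun _ : Fin N => ℝ) _
  -- transport the integrand to the product space
  have h1 : ∫ φ : Fin N → ℝ, g (fun k => φ k) * h (φ 0)
      = ∫ z : ({i : Fin N // i ≠ 0} → ℝ) × ({i : Fin N // ¬(i ≠ (0 : Fin N))} → ℝ), g z.1 * h (z.2 default) := by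
    rw [← hmp.integral_comp' (g := fun z : ({i : Fin N // i ≠ 0} → ℝ) × ({i : Fin N // ¬(i ≠ (0 : Fin N))} → ℝ) =>
      g z.1 * h (z.2 default))]
    refine integral_congr_ae (Eventually.of_forall fun φ => ?_)
    simp only [he, MeasurableEquiv.piEquivPiSubtypeProd_apply, hd]
  rw [h1, Measure.volume_eq_prod, integral_prod_mul (f := g)
    (g := fun w : {i : Fin N // ¬(i ≠ (0 : Fin N))} → ℝ => h (w default))]
  congr 1
  -- the one-dimensional factor: `∫ h(w default) dw = ∫ h`
  have hprod : (fun w : {i : Fin N // ¬(i ≠ (0 : Fin N))} → ℝ => h (w default))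
      = fun w => ∏ i : {i : Fin N // ¬(i ≠ (0 : Fin N))}, h (w i) := by
    funext w
    exact (Fintype.prod_unique (fun i : {i : Fin N // ¬(i ≠ (0 : Fin N))} => h (w i))).symm
  rw [hprod, integral_fintype_prod_volume_eq_pow (f := h), Fintype.card_unique, pow_one]

end CoV

/-! ### 3. Mehta's integral on the hyperplane: the closed form of `M^{SU}_N` -/

section Closed

variable (N : ℕ) [NeZero N]

/-- The free phases sum to zero: `Σ_b φ_b(ψ) = 0` (`φ_0 = −Σψ`). -/
theorem sum_phase_eq_zero (ψ : {i : Fin N // i ≠ 0} → ℝ) :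
    ∑ b : Fin N, (if h : b = 0 then -∑ k, ψ k else ψ ⟨b, h⟩ : ℝ) = 0 := by
  rw [← Finset.add_sum_erase _ _ (Finset.mem_univ (0 : Fin N)), dif_pos rfl,
    Finset.sum_subtype (Finset.univ.erase (0 : Fin N)) (p := fun i : Fin N => i ≠ 0) (by simp)]
  have : ∑ k : {i : Fin N // i ≠ 0}, (if h : (k : Fin N) = 0 then -∑ k, ψ k else ψ ⟨k, h⟩ : ℝ) = ∑ k, ψ k :=
    Finset.sum_congr rfl fun k _ => by rw [dif_neg k.2]
  rw [this]
  ring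

/-- The shear in terms of the phases: `((1+U)φ)_b = φ_b(φ|_{≠0}) + φ_0` for every `b`. -/
theorem suShear_apply_eq_phase_add (φ : Fin N → ℝ) (b : Fin N) :
    Matrix.mulVec ((1 : Matrix (Fin N) (Fin N) ℝ) +
        (Matrix.of fun (i : Fin N) (r : Fin 2) => if r = 0 then (if i = 0 then (0 : ℝ) else 1) else (if i = 0 then 1 else 0)) *
        (Matrix.of fun (r : Fin 2) (j : Fin N) => if r = 0 then (if j = 0 then (1 : ℝ) else 0) else (if j = 0 then 0 else -1)))
      φ b = (if h : b = 0 then -∑ k : {i : Fin N // i ≠ 0}, φ k else (fun k : {i : Fin N // i ≠ 0} => φ k) ⟨b, h⟩) + φ 0 := by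
  rw [one_add_suUpdate_mulVec]
  by_cases hb : b = 0
  · rw [if_pos hb, dif_pos hb]; ring
  · rw [if_neg hb, dif_neg hb]

/-- `Σ_b (φ_b(ψ) + v)² = Σ_b φ_b(ψ)² + N v²`. -/
theorem sum_phase_add_sq (ψ : {i : Fin N // i ≠ 0} → ℝ) (v : ℝ) :
    ∑ b : Fin N, ((if h : b = 0 then -∑ k, ψ k else ψ ⟨b, h⟩ : ℝ) + v) ^ 2
      = ∑ b : Fin N, (if h : b = 0 then -∑ k, ψ k else ψ ⟨b, h⟩ : ℝ) ^ 2 + N * v ^ 2 := by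
  have hexp : ∀ b : Fin N, ((if h : b = 0 then -∑ k, ψ k else ψ ⟨b, h⟩ : ℝ) + v) ^ 2
      = (if h : b = 0 then -∑ k, ψ k else ψ ⟨b, h⟩ : ℝ) ^ 2 +
        (2 * v * (if h : b = 0 then -∑ k, ψ k else ψ ⟨b, h⟩ : ℝ) + v ^ 2) := fun b => by ring
  simp_rw [hexp]
  rw [Finset.sum_add_distrib, Finset.sum_add_distrib, ← Finset.mul_sum, sum_phase_eq_zero, mul_zero, zero_add,
    Finset.sum_const, Finset.card_univ, Fintype.card_fin, nsmul_eq_mul]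

/-- **MEHTA'S INTEGRAL ON THE HYPERPLANE `Σφ = 0`**: for every `N ≥ 1`,
`M^{SU}_N = ∫_{ℝ^{N−1}} e^{−Σ_bφ_b(ψ)²/2} Π_{j≺k}(φ_j(ψ) − φ_k(ψ))² dψ = √(2π)^{N−1} · sf(N) / √N`. -/
theorem suGaussVandermonde_eq :
    ∫ ψ : {i : Fin N // i ≠ 0} → ℝ,
        Real.exp (∑ b, -((if h : b = 0 then -∑ k, ψ k else ψ ⟨b, h⟩) ^ 2 / 2)) *
          ∏ p : OD (Fin N), ((if h : p.1.1 = 0 then -∑ k, ψ k else ψ ⟨p.1.1, h⟩) -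
            (if h : p.1.2 = 0 then -∑ k, ψ k else ψ ⟨p.1.2, h⟩)) ^ 2
      = √(2 * π) ^ (N - 1) * N.superFactorial / √N := by
  set SU : ({i : Fin N // i ≠ 0} → ℝ) → ℝ := fun ψ =>
      Real.exp (∑ b, -((if h : b = 0 then -∑ k, ψ k else ψ ⟨b, h⟩) ^ 2 / 2)) *
        ∏ p : OD (Fin N), ((if h : p.1.1 = 0 then -∑ k, ψ k else ψ ⟨p.1.1, h⟩) -
          (if h : p.1.2 = 0 then -∑ k, ψ k else ψ ⟨p.1.2, h⟩)) ^ 2 with hSU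
  -- Mehta's integral, moved by the shear
  have hM := gaussVandermonde_eq_superFactorial N
  rw [integral_eq_mul_integral_comp_suShear N] at hM
  -- the sheared integrand splits
  have hsplit : ∀ φ : Fin N → ℝ,
      Real.exp (∑ b, -((Matrix.mulVec ((1 : Matrix (Fin N) (Fin N) ℝ) +
        (Matrix.of fun (i : Fin N) (r : Fin 2) => if r = 0 then (if i = 0 then (0 : ℝ) else 1) else (if i = 0 then 1 else 0)) *
        (Matrix.of fun (r : Fin 2) (j : Fin N) => if r = 0 then (if j = 0 then (1 : ℝ) else 0) else (if j = 0 then 0 else -1)))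
          φ b) ^ 2 / 2)) *
        ∏ p : OD (Fin N), (Matrix.mulVec ((1 : Matrix (Fin N) (Fin N) ℝ) +
        (Matrix.of fun (i : Fin N) (r : Fin 2) => if r = 0 then (if i = 0 then (0 : ℝ) else 1) else (if i = 0 then 1 else 0)) *
        (Matrix.of fun (r : Fin 2) (j : Fin N) => if r = 0 then (if j = 0 then (1 : ℝ) else 0) else (if j = 0 then 0 else -1)))
          φ p.1.1 - Matrix.mulVec ((1 : Matrix (Fin N) (Fin N) ℝ) +
        (Matrix.of fun (i : Fin N) (r : Fin 2) => if r = 0 then (if i = 0 then (0 : ℝ) else 1) else (if i = 0 then 1 else 0)) *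
        (Matrix.of fun (r : Fin 2) (j : Fin N) => if r = 0 then (if j = 0 then (1 : ℝ) else 0) else (if j = 0 then 0 else -1)))
          φ p.1.2) ^ 2
      = SU (fun k => φ k) * (fun u : ℝ => Real.exp (-((N : ℝ) / 2) * u ^ 2)) (φ 0) := by
    intro φ
    simp only [hSU, suShear_apply_eq_phase_add]
    have h1 := sum_phase_add_sq N (fun k : {i : Fin N // i ≠ 0} => φ k) (φ 0)
    have e1 : ∑ b : Fin N, -(((if h : b = 0 then -∑ k : {i : Fin N // i ≠ 0}, φ k
        else (fun k : {i : Fin N // i ≠ 0} => φ (k : Fin N)) ⟨b, h⟩) + φ 0) ^ 2 / 2)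
        = -(1 / 2) * ∑ b : Fin N, ((if h : b = 0 then -∑ k : {i : Fin N // i ≠ 0}, φ k
          else (fun k : {i : Fin N // i ≠ 0} => φ (k : Fin N)) ⟨b, h⟩) + φ 0) ^ 2 := by
      rw [Finset.mul_sum]
      exact Finset.sum_congr rfl fun b _ => by ring
    have e2 : ∑ b : Fin N, -((if h : b = 0 then -∑ k : {i : Fin N // i ≠ 0}, φ k
        else (fun k : {i : Fin N // i ≠ 0} => φ (k : Fin N)) ⟨b, h⟩) ^ 2 / 2)
        = -(1 / 2) * ∑ b : Fin N, (if h : b = 0 then -∑ k : {i : Fin N // i ≠ 0}, φ k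
          else (fun k : {i : Fin N // i ≠ 0} => φ (k : Fin N)) ⟨b, h⟩) ^ 2 := by
      rw [Finset.mul_sum]
      exact Finset.sum_congr rfl fun b _ => by ring
    have hsq : ∑ b : Fin N, -(((if h : b = 0 then -∑ k : {i : Fin N // i ≠ 0}, φ k
        else (fun k : {i : Fin N // i ≠ 0} => φ (k : Fin N)) ⟨b, h⟩) + φ 0) ^ 2 / 2)
        = (∑ b : Fin N, -((if h : b = 0 then -∑ k : {i : Fin N // i ≠ 0}, φ k
          else (fun k : {i : Fin N // i ≠ 0} => φ (k : Fin N)) ⟨b, h⟩) ^ 2 / 2)) + -((N : ℝ) / 2) * φ 0 ^ 2 := by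
      rw [e1, e2, h1]
      ring
    rw [hsq, Real.exp_add]
    have hpair : ∀ p : OD (Fin N),
        ((if h : p.1.1 = 0 then -∑ k : {i : Fin N // i ≠ 0}, φ k else (fun k : {i : Fin N // i ≠ 0} => φ (k : Fin N)) ⟨p.1.1, h⟩)
          + φ 0 - ((if h : p.1.2 = 0 then -∑ k : {i : Fin N // i ≠ 0}, φ k
            else (fun k : {i : Fin N // i ≠ 0} => φ (k : Fin N)) ⟨p.1.2, h⟩) + φ 0)) ^ 2
        = ((if h : p.1.1 = 0 then -∑ k : {i : Fin N // i ≠ 0}, φ k else (fun k : {i : Fin N // i ≠ 0} => φ (k : Fin N)) ⟨p.1.1, h⟩)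
          - (if h : p.1.2 = 0 then -∑ k : {i : Fin N // i ≠ 0}, φ k
            else (fun k : {i : Fin N // i ≠ 0} => φ (k : Fin N)) ⟨p.1.2, h⟩)) ^ 2 := fun p => by ring
    simp_rw [hpair]
    ring
  rw [integral_congr_ae (Eventually.of_forall hsplit),
    integral_pi_split_mul N SU (fun u : ℝ => Real.exp (-((N : ℝ) / 2) * u ^ 2))] at hM
  rw [integral_gaussian, show π / ((N : ℝ) / 2) = 2 * π / N by rw [div_div_eq_mul_div, mul_comm]] at hM
  -- solve for the hyperplane integral
  have hN : (0 : ℝ) < N := Nat.cast_pos.2 (NeZero.pos N)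
  have hsN : 0 < √(N : ℝ) := Real.sqrt_pos.2 hN
  have h2π : (0 : ℝ) < √(2 * π) := Real.sqrt_pos.2 (by positivity)
  have hkey : √(2 * π / N) = √(2 * π) / √N := Real.sqrt_div' _ hN.le
  have h1 : 1 ≤ N := NeZero.pos N
  have hpow : √(2 * π) ^ N = √(2 * π) ^ (N - 1) * √(2 * π) := by
    rw [← pow_succ, Nat.sub_add_cancel h1]
  have hsqN : √(N : ℝ) * √N = N := Real.mul_self_sqrt hN.le
  rw [hkey, hpow] at hM
  set X := ∫ ψ : {i : Fin N // i ≠ 0} → ℝ, SU ψ with hX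
  have h3 : (N : ℝ) * (X * (√(2 * π) / √N)) = X * √N * √(2 * π) := by
    calc (N : ℝ) * (X * (√(2 * π) / √N)) = (√(N : ℝ) * √N) * (X * (√(2 * π) / √N)) := by rw [hsqN]
      _ = X * √N * √(2 * π) := by field_simp
  rw [h3] at hM
  have h5 : X * √N * √(2 * π) = (√(2 * π) ^ (N - 1) * N.superFactorial) * √(2 * π) := by
    rw [hM]; ring
  have h4 : X * √N = √(2 * π) ^ (N - 1) * N.superFactorial := mul_right_cancel₀ h2π.ne' h5
  rw [eq_div_iff hsN.ne', h4]

end Closed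

/-! ### 4. The `SU(N)` weak-coupling constants in closed form -/

/-- `M^{SU}_N/((2π)^{N−1} N!) = sf(N)/(N! √N √(2π)^{N−1})`. -/
theorem suGaussVandermonde_div_eq (N : ℕ) [NeZero N] :
    (√(2 * π) ^ (N - 1) * (N.superFactorial : ℝ) / √N) / ((2 * π) ^ (N - 1) * N.factorial)
      = (N.superFactorial : ℝ) / (N.factorial * √N * √(2 * π) ^ (N - 1)) := by
  have h2π : (0 : ℝ) < 2 * π := by positivity
  have hs : 0 < √(2 * π) := Real.sqrt_pos.2 h2π
  have hN : (0 : ℝ) < N := Nat.cast_pos.2 (NeZero.pos N)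
  have hsN : 0 < √(N : ℝ) := Real.sqrt_pos.2 hN
  have hsq : (2 * π : ℝ) ^ (N - 1) = √(2 * π) ^ (N - 1) * √(2 * π) ^ (N - 1) := by
    rw [← mul_pow, Real.mul_self_sqrt h2π.le]
  rw [hsq, div_div, div_eq_div_iff (by positivity) (by positivity)]
  ring

/-- **THE WEAK-COUPLING LAW OF THE `SU(N)` ONE-PLAQUETTE PARTITION FUNCTION IN CLOSED FORM, EVERY `N ≥ 1`**:
`Σ_{q∈ℤ} det[I_{|q+i−j|}(x)]_{i,j<N} · e^{−Nx} · √x^{N²−1} → sf(N) / (N! · √N · √(2π)^{N−1})` as `x → ∞`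
(`sf(N)/N! = Π_{j=1}^{N−1} j!`). -/
theorem tendsto_tsum_det_besselI_weakCoupling' (N : ℕ) [NeZero N] :
    Tendsto (fun x : ℝ => (∑' q : ℤ, (Matrix.of fun i j : Fin N => besselI (q + (i : ℤ) - (j : ℤ)).natAbs x).det) *
        Real.exp (-(N * x)) * √x ^ (N ^ 2 - 1)) atTop
      (𝓝 ((N.superFactorial : ℝ) / (N.factorial * √N * √(2 * π) ^ (N - 1)))) := by
  have h := tendsto_tsum_det_besselI_weakCoupling N
  rwa [suGaussVandermonde_eq, suGaussVandermonde_div_eq] at h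

/-- **THE WEAK-COUPLING ASYMPTOTICS OF THE 2-d `SU(N)` FREE ENERGY IN CLOSED FORM, EVERY `N ≥ 1`**:
`freeEnergyDensity 2 ρ_{SU(N)} β + ((N²−1)/2) log β → log (sf(N) / (N! · √N · √(2π)^{N−1}))` as `β → ∞`. -/
theorem tendsto_specialUnitary_freeEnergyDensity_two_add_log' (N : ℕ) [NeZero N] :
    Tendsto (fun β : ℝ => freeEnergyDensity 2 (fundamentalRep (Fin N)) β + ((N : ℝ) ^ 2 - 1) / 2 * Real.log β)
      atTop (𝓝 (Real.log ((N.superFactorial : ℝ) / (N.factorial * √N * √(2 * π) ^ (N - 1))))) := by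
  have h := tendsto_specialUnitary_freeEnergyDensity_two_add_log N
  rwa [suGaussVandermonde_eq, suGaussVandermonde_div_eq] at h

/-- `SU(2)`: the closed-form constant is `log (1/√(4π)) = −½ log 4π` — GEN-20 (29)'s `SU(2)` constant, obtained there
from `z₁ = e^{−2β} I₁(2β)/β`: the two routes agree. -/
theorem specialUnitary_two_weakCoupling_constant :
    Real.log (((2 : ℕ).superFactorial : ℝ) / ((2 : ℕ).factorial * √(2 : ℕ) * √(2 * π) ^ (2 - 1)))
      = -(Real.log (4 * π) / 2) := by
  have h2π : (0 : ℝ) ≤ 2 * π := by positivity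
  have h4 : √(4 * π) = √2 * √(2 * π) := by
    rw [← Real.sqrt_mul (by norm_num : (0 : ℝ) ≤ 2), show (2 : ℝ) * (2 * π) = 4 * π by ring]
  have hs4 : 0 < √(4 * π) := Real.sqrt_pos.2 (by positivity)
  simp only [Nat.superFactorial_two, Nat.factorial_two, Nat.cast_ofNat, show (2 - 1 : ℕ) = 1 from rfl, pow_one]
  rw [show (2 : ℝ) / (2 * √2 * √(2 * π)) = 1 / √(4 * π) by rw [h4]; field_simp,
    Real.log_div one_ne_zero hs4.ne', Real.log_one, Real.log_sqrt (by positivity)]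
  ring

/-- `SU(3)`: the closed-form constant is `log (1/(√3 π)) = −log (√3 π)`, i.e.
`f_{SU(3)}(β) = −4 log β − log(√3 π) + o(1)` in two dimensions. -/
theorem specialUnitary_three_weakCoupling_constant :
    Real.log (((3 : ℕ).superFactorial : ℝ) / ((3 : ℕ).factorial * √(3 : ℕ) * √(2 * π) ^ (3 - 1)))
      = -Real.log (√3 * π) := by
  have h2π : (0 : ℝ) ≤ 2 * π := by positivity
  have hsf : ((3 : ℕ).superFactorial : ℝ) = 12 := by norm_num [Nat.superFactorial_succ, Nat.factorial]
  have hf : ((3 : ℕ).factorial : ℝ) = 6 := by norm_num [Nat.factorial]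
  have hs3 : 0 < √(3 : ℝ) := Real.sqrt_pos.2 (by norm_num)
  rw [hsf, hf, Nat.cast_ofNat, show (3 - 1 : ℕ) = 2 from rfl, Real.sq_sqrt h2π,
    show (12 : ℝ) / (6 * √3 * (2 * π)) = (√3 * π)⁻¹ by field_simp; ring, Real.log_inv]

end Summit.Ventures.LatticeQCDFlow.Scoring
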